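import Literature.NumberTheory.Rogawski1990.LocalTransferCentralSingularJunctionCM          -- carriers, `isUnit_eval_finCharpolyTwo_of_central`
import Literature.NumberTheory.Rogawski1990.LocalEndoscopicCentralDockCM                   -- ★ `coe_coe_endoEmbLocal_of_fst_eq_smul_one` (`ι(a·1₂,u) = diag(a,u,a)`)
import Literature.NumberTheory.Rogawski1990.FinExplicitTransferFactorLocallyConstant        -- ★ `continuous_fst_localMatrix`, `continuous_finGammaTwo`
import Literature.NumberTheory.Rogawski1990.FinExplicitTransferFactorNondegenerate          -- ★ charpoly bookkeeping
import Literature.NumberTheory.Rogawski1990.LocalNormFibreNonsplit                          -- ★ `charpoly_endoEmbLocal`, `IsLocalStablyConjH.finGammaTwo_eq`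
import Literature.NumberTheory.Rogawski1990.FinExplicitTransferFactorStableInvariance       -- ★ `finCharpolyTwo_eq_of_isLocalStablyConjH`
import Literature.NumberTheory.Automorphic.QuadraticLocalNormTestLocallyConstant            -- ★ `isOpen_setOf_isUnit_localRing`
import HarnessLib

/-!
# SEPARATION ALONG THE CENTRAL DOCK — `G′_v`-conjugate docked points are `H_v`-conjugate, on a STABLY SATURATED neighbourhood of `ε_H`
# (the binder `hsep′` of the (R-inv) central singular junction)

Topic `NumberTheory/Rogawski1990`; namespace `Literature.NumberTheory.Rogawski1990`.  THEOREMS ONLY (no definition, no instance, no notation, no named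
fact, no `sorry`).  Cell `pub/hodgecm-mathlib` (D-0151), crux H413 = stmt-HodgeConjecture-24833, floor-2 line «N6nsGerm» (stub `stub_N6nsS1`); LEAD F0P3a-plan (g9)
T8-83 (1) ∕ T8-86 (3), p08 (g13) 06:04:07Z ∕ 06:12:55Z («`hsep′` F0P3-p01»); seat F0P3-p01 (g12).  HONEST LABEL: HC_CM is proved only modulo the printed citations until
rung 0 closes; this file discharges ONE HYPOTHESIS (`hsep′`, c7908dea :96–:100) of ★ `exists_nhds_stableOrbitalIntegralRel_eq_of_central_singular_inv`, nothing printed.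

THE MATHEMATICS (`v` non-split, `ε_H = (a·1₂, u)`, `u ≠ a`, dock `θ : H_v ≃ₜ* Z_{G′_v}(ε)`, `θ z = y·ι_v(z)·y⁻¹` as matrices, `y·ι(ε_H)·y⁻¹ = ε`).
* CORE (algebra, no regularity): if `u(h) = u(h′)`, `χ_{g_h}(u)` and `χ_{g_{h′}}(u)` are units, and `x·θh·x⁻¹ = θh′` for some `x ∈ G′_v`, then `Z := y⁻¹ x y` intertwines
  `ι(h) = (g 0; 0 u)`-pattern and `ι(h′)`; the `u`-column and the `u`-row equations force `Z` into the pattern `(* 0 *; 0 * 0; * 0 *)` (the `2 × 2` systems have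
  matrix `u − g′`, `u − g`, invertible), so `Z` commutes with `ι(ε_H) = diag(a, u₀, a)`, i.e. `x ∈ Z_{G′}(ε) = θ(H_v)`, and `h′ = k h k⁻¹` with `k = θ⁻¹ x`.
* WINDOW: `(h, h′) ↦ χ_{g_h}(u(h′))` is continuous and a unit at `(ε_H, ε_H)` (`= (u₀ − a)²`); take a box `U ∋ ε_H` with `U × U` inside the unit locus and let
  `B₇` be its STABLE SATURATION — still inside the unit locus because `χ_g` and `u` are stable-class invariants — a stably saturated neighbourhood of `ε_H`.
* On `B₇`, `x θh x⁻¹ = θh′` gives equal characteristic polynomials `χ_g·(X − u) = χ_{g′}·(X − u′)`; evaluating at `u′` and using the window kills `u′ − u`,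
  and the CORE applies.  [Rogawski1990 §8.2 Prop. 8.2.1 (a) p. 112 (the two classes `ε, ε′` and the centraliser `Z(ε) ≅ H`); §4.8 p. 53; HarishChandra1970 II §5.]

## References
* [Rogawski1990] J. Rogawski, *Automorphic Representations of Unitary Groups in Three Variables*, Ann. of Math. Stud. 123 (1990): §4.8 p. 53; §8.2 Prop. 8.2.1 p. 112.
* [HarishChandra1970] Harish-Chandra (notes by G. van Dijk), *Harmonic Analysis on Reductive p-adic Groups*, LNM 162 (1970): Part II §5.
-/

set_option autoImplicit false

noncomputable section

open Set Filter Topology Polynomial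
open scoped Matrix

namespace Literature.NumberTheory.Rogawski1990

open Literature.NumberTheory.Automorphic Literature.NumberTheory.Automorphic.UnitaryGroup Literature.NumberTheory.GaloisRepresentations
open _root_.NumberField _root_.IsDedekindDomain _root_.Matrix

section DockSeparation

variable {L : Type} [Field L] [NumberField L] [IsCMField L] {H' : Matrix (Fin 3) (Fin 3) L} {v : HeightOneSpectrum (𝓞 ↥(maximalRealSubfield L))}

/-! ## §1 The matrix of a docked point -/

/-- `ι_v(h)` as an explicit matrix `(g₀₀ 0 g₀₁; 0 u 0; g₁₀ 0 g₁₁)`. [cite: Rogawski1990, §4.8 Case (a) p. 53] -/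
theorem coe_coe_endoEmbLocal_eq
    (h : (cmDatum L 2 (Matrix.of fun i j : Fin 2 => if i.val + j.val + 1 = 2 then (1 : L) else 0)).Local v ×
      (cmDatum L 1 (Matrix.of fun i j : Fin 1 => if i.val + j.val + 1 = 1 then (1 : L) else 0)).Local v) :
    (((endoEmbLocal L v h).val : GL (Fin 3) (LocalRing L v)).val : Matrix (Fin 3) (Fin 3) (LocalRing L v)) =
      !![(h.1.val.val : Matrix (Fin 2) (Fin 2) (LocalRing L v)) 0 0, 0, (h.1.val.val : Matrix (Fin 2) (Fin 2) (LocalRing L v)) 0 1;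
        0, finGammaTwo L v h, 0;
        (h.1.val.val : Matrix (Fin 2) (Fin 2) (LocalRing L v)) 1 0, 0, (h.1.val.val : Matrix (Fin 2) (Fin 2) (LocalRing L v)) 1 1] := by
  rw [coe_endoEmbLocal, coe_endoGL_eq]
  rfl

/-- `g b g⁻¹ = b′` in `GL` gives `g·b = b′·g` on matrices. [folklore] -/
private theorem val_mul_val_eq_of_conj_eq' {n : Type} [Fintype n] [DecidableEq n] {R : Type} [CommRing R] {g b b' : GL n R} (hg : g * b * g⁻¹ = b') :
    g.val * b.val = b'.val * g.val := by
  have h : g * b = b' * g := by rw [← hg, inv_mul_cancel_right]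
  rw [← Units.val_mul, h, Units.val_mul]

/-- A `2 × 2` homogeneous system with invertible matrix has only the trivial solution (columns). [folklore] -/
private theorem eq_zero_of_mulVec_eq_zero_of_isUnit {R : Type} [CommRing R] {A : Matrix (Fin 2) (Fin 2) R} (hA : IsUnit A.det)
    {c : Fin 2 → R} (hc : A *ᵥ c = 0) : c = 0 := by
  have h1 : A⁻¹ * A = 1 := Matrix.nonsing_inv_mul A hA
  calc c = (A⁻¹ * A) *ᵥ c := by rw [h1, one_mulVec]
    _ = 0 := by rw [← mulVec_mulVec, hc, mulVec_zero]

/-- … and (rows). [folklore] -/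
private theorem eq_zero_of_vecMul_eq_zero_of_isUnit {R : Type} [CommRing R] {A : Matrix (Fin 2) (Fin 2) R} (hA : IsUnit A.det)
    {c : Fin 2 → R} (hc : c ᵥ* A = 0) : c = 0 := by
  have h1 : A * A⁻¹ = 1 := Matrix.mul_nonsing_inv A hA
  calc c = c ᵥ* (A * A⁻¹) := by rw [h1, vecMul_one]
    _ = 0 := by rw [← vecMul_vecMul, hc, zero_vecMul]

/-- `χ_g(u) = det(u·1 − g)` is the determinant of the `2 × 2` system. [folklore] -/
private theorem isUnit_det_scalar_sub_of_isUnit_eval {R : Type} [CommRing R] {g : Matrix (Fin 2) (Fin 2) R} {u : R}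
    (hu : IsUnit (g.charpoly.eval u)) : IsUnit (Matrix.scalar (Fin 2) u - g).det := by
  rwa [← Matrix.eval_charpoly]

/-! ## §2 CORE: conjugators of docked points with the same `u` lie in `Z(ε)` -/

/-- **THE BLOCK PATTERN OF AN INTERTWINER** (pure algebra): if `Z·ι(h) = ι(h′)·Z`, `u(h) = u(h′) =: u`, and `χ_{g_h}(u)`, `χ_{g_{h′}}(u)` are units, then
`Z₀₁ = Z₂₁ = Z₁₀ = Z₁₂ = 0` (the `u`-column of `Z` solves `(u − g′)·c = 0`, the `u`-row solves `r·(u − g) = 0`). [cite: Rogawski1990, §4.8 Case (a) p. 53] -/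
theorem pattern_of_mul_endoEmbLocal_eq
    {h h' : (cmDatum L 2 (Matrix.of fun i j : Fin 2 => if i.val + j.val + 1 = 2 then (1 : L) else 0)).Local v ×
      (cmDatum L 1 (Matrix.of fun i j : Fin 1 => if i.val + j.val + 1 = 1 then (1 : L) else 0)).Local v}
    (hγ : finGammaTwo L v h = finGammaTwo L v h')
    (hu : IsUnit ((finCharpolyTwo L v h).eval (finGammaTwo L v h))) (hu' : IsUnit ((finCharpolyTwo L v h').eval (finGammaTwo L v h')))
    {Z : Matrix (Fin 3) (Fin 3) (LocalRing L v)}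
    (hZ : Z * (((endoEmbLocal L v h).val : GL (Fin 3) (LocalRing L v)).val : Matrix (Fin 3) (Fin 3) (LocalRing L v)) =
      (((endoEmbLocal L v h').val : GL (Fin 3) (LocalRing L v)).val : Matrix (Fin 3) (Fin 3) (LocalRing L v)) * Z) :
    Z 0 1 = 0 ∧ Z 2 1 = 0 ∧ Z 1 0 = 0 ∧ Z 1 2 = 0 := by
  rw [coe_coe_endoEmbLocal_eq h, coe_coe_endoEmbLocal_eq h', ← hγ] at hZ
  have e := fun i j => congrFun (congrFun hZ i) j
  -- entries of `Z·ι(h) = ι(h′)·Z`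
  have e01 := e 0 1; have e21 := e 2 1; have e10 := e 1 0; have e12 := e 1 2
  simp only [Matrix.mul_apply, Fin.sum_univ_three, Matrix.of_apply, Matrix.cons_val', Matrix.cons_val_zero, Matrix.cons_val_one,
    Matrix.cons_val_two, Matrix.empty_val', Matrix.cons_val_fin_one, Matrix.head_cons, Matrix.tail_cons, Matrix.head_fin_const,
    mul_zero, zero_mul, add_zero, zero_add] at e01 e21 e10 e12
  -- the column system `(u − g′) c = 0`, `c = (Z₀₁, Z₂₁)`
  have hcol : (Matrix.scalar (Fin 2) (finGammaTwo L v h) - (h'.1.val.val : Matrix (Fin 2) (Fin 2) (LocalRing L v))) *ᵥ ![Z 0 1, Z 2 1] = 0 := by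
    funext i
    fin_cases i
    · simp [Matrix.mulVec, dotProduct, Fin.sum_univ_two, Matrix.scalar_apply, Matrix.diagonal]
      linear_combination e01
    · simp [Matrix.mulVec, dotProduct, Fin.sum_univ_two, Matrix.scalar_apply, Matrix.diagonal]
      linear_combination e21
  have hu'2 : IsUnit ((Matrix.scalar (Fin 2) (finGammaTwo L v h) - (h'.1.val.val : Matrix (Fin 2) (Fin 2) (LocalRing L v))).det) := by
    rw [hγ]
    exact isUnit_det_scalar_sub_of_isUnit_eval hu'
  have hc0 := eq_zero_of_mulVec_eq_zero_of_isUnit hu'2 hcol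
  -- the row system `r (u − g) = 0`, `r = (Z₁₀, Z₁₂)`
  have hrow : ![Z 1 0, Z 1 2] ᵥ* (Matrix.scalar (Fin 2) (finGammaTwo L v h) - (h.1.val.val : Matrix (Fin 2) (Fin 2) (LocalRing L v))) = 0 := by
    funext j
    fin_cases j
    · simp [Matrix.vecMul, dotProduct, Fin.sum_univ_two, Matrix.scalar_apply, Matrix.diagonal]
      linear_combination -e10
    · simp [Matrix.vecMul, dotProduct, Fin.sum_univ_two, Matrix.scalar_apply, Matrix.diagonal]
      linear_combination -e12
  have hu2 : IsUnit ((Matrix.scalar (Fin 2) (finGammaTwo L v h) - (h.1.val.val : Matrix (Fin 2) (Fin 2) (LocalRing L v))).det) :=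
    isUnit_det_scalar_sub_of_isUnit_eval hu
  have hr0 := eq_zero_of_vecMul_eq_zero_of_isUnit hu2 hrow
  have c0 := congrFun hc0 0; have c1 := congrFun hc0 1; have r0 := congrFun hr0 0; have r1 := congrFun hr0 1
  simp only [Matrix.cons_val_zero, Matrix.cons_val_one, Pi.zero_apply] at c0 c1 r0 r1
  exact ⟨c0, c1, r0, r1⟩

/-- A matrix with the pattern `(* 0 *; 0 * 0; * 0 *)` commutes with `diag(a, u, a)`. [folklore] -/
private theorem mul_diag_eq_diag_mul_of_pattern {R : Type} [CommRing R] {Z : Matrix (Fin 3) (Fin 3) R} (a u : R)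
    (h01 : Z 0 1 = 0) (h21 : Z 2 1 = 0) (h10 : Z 1 0 = 0) (h12 : Z 1 2 = 0) :
    Z * !![a, 0, 0; 0, u, 0; 0, 0, a] = !![a, 0, 0; 0, u, 0; 0, 0, a] * Z := by
  ext i j
  fin_cases i <;> fin_cases j <;>
    simp [Matrix.mul_apply, Fin.sum_univ_three, h01, h21, h10, h12, mul_comm]

set_option maxHeartbeats 400000 in
/-- **CORE — SEPARATION ALONG THE DOCK (no regularity)**: with the dock data, if `u(h) = u(h′)`, `χ_{g_h}(u(h))` and `χ_{g_{h′}}(u(h′))` are units and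
`x·(θ h)·x⁻¹ = θ h′` for some `x ∈ G′_v`, then `x ∈ Z_{G′_v}(ε)` and `h′ = k h k⁻¹` for `k = θ⁻¹ x`; in particular `IsConj h h′`.
[cite: Rogawski1990, §8.2 Prop. 8.2.1 (a) p. 112; §4.8 Case (a) p. 53] [cite: HarishChandra1970, Part II §5] -/
theorem isConj_of_dock_conj_eq
    (εH : ((cmDatum L 2 (Matrix.of fun i j : Fin 2 => if i.val + j.val + 1 = 2 then (1 : L) else 0)).Local v ×
      (cmDatum L 1 (Matrix.of fun i j : Fin 1 => if i.val + j.val + 1 = 1 then (1 : L) else 0)).Local v)) (a : LocalRing L v)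
    (ha : (εH.1.val.val : Matrix (Fin 2) (Fin 2) (LocalRing L v)) = a • (1 : Matrix (Fin 2) (Fin 2) (LocalRing L v)))
    (ε : (cmDatum L 3 H').Local v) (y : GL (Fin 3) (LocalRing L v))
    (θ : ((cmDatum L 2 (Matrix.of fun i j : Fin 2 => if i.val + j.val + 1 = 2 then (1 : L) else 0)).Local v ×
      (cmDatum L 1 (Matrix.of fun i j : Fin 1 => if i.val + j.val + 1 = 1 then (1 : L) else 0)).Local v) ≃ₜ* ↥(Subgroup.centralizer ({ε} : Set ((cmDatum L 3 H').Local v))))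
    (hy : y * ((endoEmbLocal L v εH).val : GL (Fin 3) (LocalRing L v)) * y⁻¹ = ε.val)
    (hθ : ∀ z : ((cmDatum L 2 (Matrix.of fun i j : Fin 2 => if i.val + j.val + 1 = 2 then (1 : L) else 0)).Local v ×
      (cmDatum L 1 (Matrix.of fun i j : Fin 1 => if i.val + j.val + 1 = 1 then (1 : L) else 0)).Local v), (((θ z).1).val : GL (Fin 3) (LocalRing L v)) = y * ((endoEmbLocal L v z).val : GL (Fin 3) (LocalRing L v)) * y⁻¹)
    {h h' : (cmDatum L 2 (Matrix.of fun i j : Fin 2 => if i.val + j.val + 1 = 2 then (1 : L) else 0)).Local v ×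
      (cmDatum L 1 (Matrix.of fun i j : Fin 1 => if i.val + j.val + 1 = 1 then (1 : L) else 0)).Local v}
    (hγ : finGammaTwo L v h = finGammaTwo L v h')
    (hu : IsUnit ((finCharpolyTwo L v h).eval (finGammaTwo L v h))) (hu' : IsUnit ((finCharpolyTwo L v h').eval (finGammaTwo L v h')))
    {x : (cmDatum L 3 H').Local v}
    (hx : x * ((θ h : ↥(Subgroup.centralizer ({ε} : Set ((cmDatum L 3 H').Local v)))) : (cmDatum L 3 H').Local v) * x⁻¹ =
      ((θ h' : ↥(Subgroup.centralizer ({ε} : Set ((cmDatum L 3 H').Local v)))) : (cmDatum L 3 H').Local v)) :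
    IsConj h h' := by
  -- `x·θh·x⁻¹ = θh′` in `GL₃`
  have hxGL : (x.val : GL (Fin 3) (LocalRing L v)) * (y * (endoEmbLocal L v h).val * y⁻¹) * (x.val : GL (Fin 3) (LocalRing L v))⁻¹ =
      y * (endoEmbLocal L v h').val * y⁻¹ := by
    rw [← hθ h, ← hθ h']
    exact congrArg (fun g : (cmDatum L 3 H').Local v => (g.val : GL (Fin 3) (LocalRing L v))) hx
  -- `Z := y⁻¹ x y` intertwines `ι h` and `ι h′`
  set Zg : GL (Fin 3) (LocalRing L v) := y⁻¹ * (x.val : GL (Fin 3) (LocalRing L v)) * y with hZg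
  have hZGL : Zg * (endoEmbLocal L v h).val * Zg⁻¹ = (endoEmbLocal L v h').val := by
    calc Zg * (endoEmbLocal L v h).val * Zg⁻¹
        = y⁻¹ * ((x.val : GL (Fin 3) (LocalRing L v)) * (y * (endoEmbLocal L v h).val * y⁻¹) * (x.val : GL (Fin 3) (LocalRing L v))⁻¹) * y := by
          rw [hZg]; group
      _ = y⁻¹ * (y * (endoEmbLocal L v h').val * y⁻¹) * y := by rw [hxGL]
      _ = (endoEmbLocal L v h').val := by group
  have hZ := val_mul_val_eq_of_conj_eq' hZGL
  obtain ⟨h01, h21, h10, h12⟩ := pattern_of_mul_endoEmbLocal_eq hγ hu hu' hZ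
  -- `Z` commutes with `ι(ε_H) = diag(a, u₀, a)`
  have hD : (((endoEmbLocal L v εH).val : GL (Fin 3) (LocalRing L v)).val : Matrix (Fin 3) (Fin 3) (LocalRing L v)) =
      !![a, 0, 0; 0, (εH.2.val.val : Matrix (Fin 1) (Fin 1) (LocalRing L v)) 0 0, 0; 0, 0, a] :=
    coe_coe_endoEmbLocal_of_fst_eq_smul_one L v εH a ha
  have hZD := mul_diag_eq_diag_mul_of_pattern a ((εH.2.val.val : Matrix (Fin 1) (Fin 1) (LocalRing L v)) 0 0) h01 h21 h10 h12
  rw [← hD] at hZD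
  have hZDg : Zg * (endoEmbLocal L v εH).val = (endoEmbLocal L v εH).val * Zg := Units.ext (by simpa only [Units.val_mul] using hZD)
  -- hence `x` commutes with `ε`
  have hxε : (x.val : GL (Fin 3) (LocalRing L v)) * ε.val = ε.val * (x.val : GL (Fin 3) (LocalRing L v)) := by
    have hxZ : (x.val : GL (Fin 3) (LocalRing L v)) = y * Zg * y⁻¹ := by rw [hZg]; group
    rw [← hy, hxZ]
    calc y * Zg * y⁻¹ * (y * (endoEmbLocal L v εH).val * y⁻¹) = y * (Zg * (endoEmbLocal L v εH).val) * y⁻¹ := by group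
      _ = y * ((endoEmbLocal L v εH).val * Zg) * y⁻¹ := by rw [hZDg]
      _ = y * (endoEmbLocal L v εH).val * y⁻¹ * (y * Zg * y⁻¹) := by group
  have hxZ : x ∈ Subgroup.centralizer ({ε} : Set ((cmDatum L 3 H').Local v)) := by
    rw [Subgroup.mem_centralizer_singleton_iff]
    apply Subtype.ext
    exact hxε
  -- pull back through `θ`
  set k := θ.symm ⟨x, hxZ⟩ with hk
  have hθk : θ k = ⟨x, hxZ⟩ := by rw [hk, ContinuousMulEquiv.apply_symm_apply]
  refine isConj_iff.2 ⟨k, θ.injective ?_⟩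
  apply Subtype.ext
  rw [map_mul, map_mul, map_inv, hθk, Subgroup.coe_mul, Subgroup.coe_mul, Subgroup.coe_inv]
  exact hx

/-! ## §3 WINDOW: a stably saturated neighbourhood of `ε_H` on which `χ_{g_h}(u(h′))` is a unit -/

/-- `χ_{g_h}(t) = t² − tr(g_h)·t + det(g_h)` (`2 × 2` characteristic polynomial). [folklore] -/
private theorem eval_finCharpolyTwo_eq
    (h : (cmDatum L 2 (Matrix.of fun i j : Fin 2 => if i.val + j.val + 1 = 2 then (1 : L) else 0)).Local v ×
      (cmDatum L 1 (Matrix.of fun i j : Fin 1 => if i.val + j.val + 1 = 1 then (1 : L) else 0)).Local v) (t : LocalRing L v) :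
    (finCharpolyTwo L v h).eval t =
      t * t - (h.1.val.val : Matrix (Fin 2) (Fin 2) (LocalRing L v)).trace * t + (h.1.val.val : Matrix (Fin 2) (Fin 2) (LocalRing L v)).det := by
  haveI : Nontrivial (LocalRing L v) := by
    obtain ⟨w⟩ := (inferInstance : Nonempty (PlacesOver L v))
    exact ⟨⟨0, 1, fun h0 => zero_ne_one (congrFun h0 w)⟩⟩
  rw [finCharpolyTwo, Matrix.charpoly_fin_two]
  simp [sq]

/-- **THE WINDOW**: a STABLY SATURATED neighbourhood `B₇ ∋ ε_H` with `χ_{g_h}(u(h′))` a unit for all `h, h′ ∈ B₇` (continuity of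
`(h, h′) ↦ u(h′)² − tr(g_h) u(h′) + det g_h`, the value `(u₀ − a)²` at `(ε_H, ε_H)` being a unit, and invariance of `χ_g`, `u` under stable conjugacy).
[cite: Rogawski1990, §8.2 Prop. 8.2.1 (a) p. 112; Prop. 8.1.3 proof p. 116] -/
theorem exists_nhds_stablySaturated_isUnit_eval (w : PlacesOver L v) (hw : IsCMField.complexConj L • w.1 = w.1)
    (εH : ((cmDatum L 2 (Matrix.of fun i j : Fin 2 => if i.val + j.val + 1 = 2 then (1 : L) else 0)).Local v ×
      (cmDatum L 1 (Matrix.of fun i j : Fin 1 => if i.val + j.val + 1 = 1 then (1 : L) else 0)).Local v)) (a : LocalRing L v)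
    (ha : (εH.1.val.val : Matrix (Fin 2) (Fin 2) (LocalRing L v)) = a • (1 : Matrix (Fin 2) (Fin 2) (LocalRing L v)))
    (hu : (εH.2.val.val : Matrix (Fin 1) (Fin 1) (LocalRing L v)) 0 0 ≠ a) :
    ∃ B₇ ∈ 𝓝 εH,
      (∀ h ∈ B₇, ∀ h' : ((cmDatum L 2 (Matrix.of fun i j : Fin 2 => if i.val + j.val + 1 = 2 then (1 : L) else 0)).Local v ×
        (cmDatum L 1 (Matrix.of fun i j : Fin 1 => if i.val + j.val + 1 = 1 then (1 : L) else 0)).Local v), IsLocalStablyConjH L v h h' → h' ∈ B₇) ∧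
      ∀ h ∈ B₇, ∀ h' ∈ B₇, IsUnit ((finCharpolyTwo L v h).eval (finGammaTwo L v h')) := by
  -- the continuous function `F(h, h′) = χ_{g_h}(u(h′))` and its unit locus
  set F : (((cmDatum L 2 (Matrix.of fun i j : Fin 2 => if i.val + j.val + 1 = 2 then (1 : L) else 0)).Local v ×
        (cmDatum L 1 (Matrix.of fun i j : Fin 1 => if i.val + j.val + 1 = 1 then (1 : L) else 0)).Local v) ×
      ((cmDatum L 2 (Matrix.of fun i j : Fin 2 => if i.val + j.val + 1 = 2 then (1 : L) else 0)).Local v ×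
        (cmDatum L 1 (Matrix.of fun i j : Fin 1 => if i.val + j.val + 1 = 1 then (1 : L) else 0)).Local v)) → LocalRing L v :=
    fun p => (finCharpolyTwo L v p.1).eval (finGammaTwo L v p.2) with hF
  have hFc : Continuous F := by
    have hg := (continuous_fst_localMatrix L v).comp
      (continuous_fst : Continuous fun p : (((cmDatum L 2 (Matrix.of fun i j : Fin 2 => if i.val + j.val + 1 = 2 then (1 : L) else 0)).Local v ×
        (cmDatum L 1 (Matrix.of fun i j : Fin 1 => if i.val + j.val + 1 = 1 then (1 : L) else 0)).Local v) ×
      ((cmDatum L 2 (Matrix.of fun i j : Fin 2 => if i.val + j.val + 1 = 2 then (1 : L) else 0)).Local v ×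
        (cmDatum L 1 (Matrix.of fun i j : Fin 1 => if i.val + j.val + 1 = 1 then (1 : L) else 0)).Local v)) => p.1)
    have hu' := (continuous_finGammaTwo L v).comp
      (continuous_snd : Continuous fun p : (((cmDatum L 2 (Matrix.of fun i j : Fin 2 => if i.val + j.val + 1 = 2 then (1 : L) else 0)).Local v ×
        (cmDatum L 1 (Matrix.of fun i j : Fin 1 => if i.val + j.val + 1 = 1 then (1 : L) else 0)).Local v) ×
      ((cmDatum L 2 (Matrix.of fun i j : Fin 2 => if i.val + j.val + 1 = 2 then (1 : L) else 0)).Local v ×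
        (cmDatum L 1 (Matrix.of fun i j : Fin 1 => if i.val + j.val + 1 = 1 then (1 : L) else 0)).Local v)) => p.2)
    have hF' : F = fun p => finGammaTwo L v p.2 * finGammaTwo L v p.2 -
        (p.1.1.val.val : Matrix (Fin 2) (Fin 2) (LocalRing L v)).trace * finGammaTwo L v p.2 + (p.1.1.val.val : Matrix (Fin 2) (Fin 2) (LocalRing L v)).det := by
      funext p; rw [hF]; exact eval_finCharpolyTwo_eq p.1 _
    rw [hF']
    exact ((hu'.mul hu').sub (hg.matrix_trace.mul hu')).add hg.matrix_det
  have hS : {p | IsUnit (F p)} ∈ 𝓝 (εH, εH) := by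
    refine (hFc.isOpen_preimage _ (UnitaryGroup.isOpen_setOf_isUnit_localRing L v)).mem_nhds ?_
    show IsUnit (F (εH, εH))
    rw [hF]
    exact isUnit_eval_finCharpolyTwo_of_central L v w hw εH a ha hu
  obtain ⟨U₁, hU₁, U₂, hU₂, hUU⟩ := mem_nhds_prod_iff.1 hS
  -- the stable saturation of `U := U₁ ∩ U₂`
  refine ⟨{h | ∃ h₀ ∈ U₁ ∩ U₂, IsLocalStablyConjH L v h₀ h}, ?_, ?_, ?_⟩
  · exact Filter.mem_of_superset (Filter.inter_mem hU₁ hU₂) fun h hh => ⟨h, hh, IsStablyConjH.refl _ _ _ h⟩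
  · rintro h ⟨h₀, hh₀, hst⟩ h' hst'
    exact ⟨h₀, hh₀, hst.trans hst'⟩
  · rintro h ⟨h₀, hh₀, hst⟩ h' ⟨h₀', hh₀', hst'⟩
    have h1 : finCharpolyTwo L v h = finCharpolyTwo L v h₀ := finCharpolyTwo_eq_of_isLocalStablyConjH L v hst
    have h2 : finGammaTwo L v h' = finGammaTwo L v h₀' := finGammaTwo_eq_of_isLocalStablyConjH L v hst'
    have h3 : IsUnit (F (h₀, h₀')) := hUU (Set.mk_mem_prod hh₀.1 hh₀'.2)
    rw [hF] at h3
    rw [h1, h2]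
    exact h3

/-! ## §4 The binder `hsep′` -/

/-- **SEPARATION ALONG THE CENTRAL DOCK ON A STABLY SATURATED NEIGHBOURHOOD** — the binder `hsep′` of ★
`exists_nhds_stableOrbitalIntegralRel_eq_of_central_singular_inv` VERBATIM: for the central `(G,H)`-regular `ε_H = (a·1₂, u)` (`u ≠ a`) at a non-split `v` and
the dock `θ : H_v ≃ₜ* Z_{G′_v}(ε)` (`θ z = y·ι_v(z)·y⁻¹`, `y·ι_v(ε_H)·y⁻¹ = ε`), there is a STABLY SATURATED neighbourhood `B₇ ∋ ε_H` such that `G′_v`-conjugate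
docked points of `B₇` are `H_v`-conjugate.  Proof: on the WINDOW `x θh x⁻¹ = θh′` gives equal characteristic polynomials `χ_g·(X − u) = χ_{g′}·(X − u′)`
(★ `charpoly_endoEmbLocal`); evaluating at `u′` the unit `χ_g(u′)` kills `u′ − u`, and the CORE applies.
[cite: Rogawski1990, §8.2 Prop. 8.2.1 (a) p. 112; §4.8 Case (a) p. 53] [cite: HarishChandra1970, Part II §5] -/
theorem exists_nhds_stablySaturated_sep_dock (w : PlacesOver L v) (hw : IsCMField.complexConj L • w.1 = w.1)
    (εH : ((cmDatum L 2 (Matrix.of fun i j : Fin 2 => if i.val + j.val + 1 = 2 then (1 : L) else 0)).Local v ×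
      (cmDatum L 1 (Matrix.of fun i j : Fin 1 => if i.val + j.val + 1 = 1 then (1 : L) else 0)).Local v)) (a : LocalRing L v)
    (ha : (εH.1.val.val : Matrix (Fin 2) (Fin 2) (LocalRing L v)) = a • (1 : Matrix (Fin 2) (Fin 2) (LocalRing L v)))
    (hu : (εH.2.val.val : Matrix (Fin 1) (Fin 1) (LocalRing L v)) 0 0 ≠ a)
    (ε : (cmDatum L 3 H').Local v) (y : GL (Fin 3) (LocalRing L v))
    (θ : ((cmDatum L 2 (Matrix.of fun i j : Fin 2 => if i.val + j.val + 1 = 2 then (1 : L) else 0)).Local v ×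
      (cmDatum L 1 (Matrix.of fun i j : Fin 1 => if i.val + j.val + 1 = 1 then (1 : L) else 0)).Local v) ≃ₜ* ↥(Subgroup.centralizer ({ε} : Set ((cmDatum L 3 H').Local v))))
    (hy : y * ((endoEmbLocal L v εH).val : GL (Fin 3) (LocalRing L v)) * y⁻¹ = ε.val)
    (hθ : ∀ z : ((cmDatum L 2 (Matrix.of fun i j : Fin 2 => if i.val + j.val + 1 = 2 then (1 : L) else 0)).Local v ×
      (cmDatum L 1 (Matrix.of fun i j : Fin 1 => if i.val + j.val + 1 = 1 then (1 : L) else 0)).Local v), (((θ z).1).val : GL (Fin 3) (LocalRing L v)) = y * ((endoEmbLocal L v z).val : GL (Fin 3) (LocalRing L v)) * y⁻¹) :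
    ∃ B₇ ∈ 𝓝 εH, (∀ h ∈ B₇, ∀ h' : ((cmDatum L 2 (Matrix.of fun i j : Fin 2 => if i.val + j.val + 1 = 2 then (1 : L) else 0)).Local v ×
      (cmDatum L 1 (Matrix.of fun i j : Fin 1 => if i.val + j.val + 1 = 1 then (1 : L) else 0)).Local v), IsLocalStablyConjH L v h h' → h' ∈ B₇) ∧
      ∀ h ∈ B₇, ∀ h' ∈ B₇, ∀ x : (cmDatum L 3 H').Local v, x * ((θ h : ↥(Subgroup.centralizer ({ε} : Set ((cmDatum L 3 H').Local v)))) : (cmDatum L 3 H').Local v) * x⁻¹ = ((θ h' : ↥(Subgroup.centralizer ({ε} : Set ((cmDatum L 3 H').Local v)))) : (cmDatum L 3 H').Local v) → IsConj h h' := by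
  obtain ⟨B₇, hB₇, hsat, hunit⟩ := exists_nhds_stablySaturated_isUnit_eval w hw εH a ha hu
  refine ⟨B₇, hB₇, hsat, fun h hh h' hh' x hx => ?_⟩
  -- `u(h) = u(h′)` from the characteristic polynomials
  have hxGL : (x.val : GL (Fin 3) (LocalRing L v)) * (y * (endoEmbLocal L v h).val * y⁻¹) * (x.val : GL (Fin 3) (LocalRing L v))⁻¹ =
      y * (endoEmbLocal L v h').val * y⁻¹ := by
    rw [← hθ h, ← hθ h']
    exact congrArg (fun g : (cmDatum L 3 H').Local v => (g.val : GL (Fin 3) (LocalRing L v))) hx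
  have hZGL : (y⁻¹ * (x.val : GL (Fin 3) (LocalRing L v)) * y) * (endoEmbLocal L v h).val * (y⁻¹ * (x.val : GL (Fin 3) (LocalRing L v)) * y)⁻¹ =
      (endoEmbLocal L v h').val := by
    calc (y⁻¹ * (x.val : GL (Fin 3) (LocalRing L v)) * y) * (endoEmbLocal L v h).val * (y⁻¹ * (x.val : GL (Fin 3) (LocalRing L v)) * y)⁻¹
        = y⁻¹ * ((x.val : GL (Fin 3) (LocalRing L v)) * (y * (endoEmbLocal L v h).val * y⁻¹) * (x.val : GL (Fin 3) (LocalRing L v))⁻¹) * y := by group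
      _ = y⁻¹ * (y * (endoEmbLocal L v h').val * y⁻¹) * y := by rw [hxGL]
      _ = (endoEmbLocal L v h').val := by group
  have hchar : (((endoEmbLocal L v h).val : GL (Fin 3) (LocalRing L v)).val : Matrix (Fin 3) (Fin 3) (LocalRing L v)).charpoly =
      (((endoEmbLocal L v h').val : GL (Fin 3) (LocalRing L v)).val : Matrix (Fin 3) (Fin 3) (LocalRing L v)).charpoly := by
    rw [← hZGL, Units.val_mul, Units.val_mul, Matrix.coe_units_inv, Matrix.charpoly_units_conj]
  rw [charpoly_endoEmbLocal, charpoly_endoEmbLocal] at hchar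
  have hev := congrArg (fun q : (LocalRing L v)[X] => q.eval (finGammaTwo L v h')) hchar
  simp only [eval_mul, eval_sub, eval_X, eval_C, sub_self, mul_zero] at hev
  -- `χ_g(u′)·(u′ − u) = 0` with `χ_g(u′)` a unit
  have hγ : finGammaTwo L v h = finGammaTwo L v h' := by
    have h0 : finGammaTwo L v h' - finGammaTwo L v h = 0 := (hunit h hh h' hh').mul_right_eq_zero.1 hev
    exact (sub_eq_zero.1 h0).symm
  exact isConj_of_dock_conj_eq εH a ha ε y θ hy hθ hγ (hunit h hh h hh) (hunit h' hh' h' hh') hx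

end DockSeparation

end Literature.NumberTheory.Rogawski1990

end
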